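import Summits.QuantumFields.BalabanUV.Beta.GAN24.WardPairingCoarseStep
import Summits.QuantumFields.BalabanUV.Beta.GAN24.BlockDivergenceFlux

/-!
# `BalabanUV.Beta.GAN24.WardPairingCoarseFlux` — binder row G-an2-4 ∕ (CONV-C), W-slot CT-W, the (DL) question Q-g30-1: **«PAIR-COARSE» IN THE «FLUX-REC» CURRENCY —
# THE MULTIPLIER COLUMN's COARSE CODIFFERENTIAL IS −(border normalisation)⁻¹ × THE LETTER's BLOCK FLUX** — the OWNER gan24-p1 g30's sentence «the multiplier leg reads
# only TOTAL block flux» (RULING R-gan24p1-g30-1 (vi)) as a tree identity: PART 1∕2's law (`WardPairingCoarse.pow_mul_codiff₁_multiplierCol_eq`,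
# `WardPairingCoarseStep.stepScale_mul_pow_mul_codiff₁_multiplierCol_eq`) has on its right side `blockSum (codiff₁ W^F_{x,b})`, and for a table column that IS an
# entry of a slot-field letter `S` this is EXACTLY the entry of the block flux `Σ_{v ∈ box} divV S (Lc•y₀ + v)` that leaf-03 g58∕g62's «FLUX-REC» files
# (`BlockDivergenceFlux`, `BoundaryFluxRecursion`, `BlockFluxRegion ∕ Tower ∕ Mass…`) transport and price
# (G-an2-4 formalisation swarm → CRUX TEAM (2), leaf prover `b2b-balaban-gan24-formalise-leaf-03`, gen 63, PART 3 of «PAIR-COARSE»; module name PROVISIONAL)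

NOT IN PRINT; OUR BOOKKEEPING ([folklore]: the sign∕`unitVec` conventions of an5's `AffineAveraging.codiff₁` and an2's `KernelWard.divV` agree
(`AveragingWardStencils.b6UnitVec_eq`); my g58 `BlockDivergenceFlux.boxSum_sub_shift_eq_faces` (scalar divergence theorem on a block) BY NAME; 0 `def`, 0 cited
facts, 0 `def … : Prop`, 0 sorry).  HONEST FRAMING (cell contract, verbatim): «discharging `BetaPertH` makes Bałaban's UV stability UNCONDITIONAL — a real
constructive-QFT result; it is NOT the continuum limit and NOT the Clay problem.»  HONEST DEPENDENCY (verbatim): «continuum YM on T⁴ ⇐ BetaPertH ∧ nine spine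
estimates (0/9 proved); BetaPertH ⇐ (D1) ∧ (D4) ∧ CAP+tail; G-an2-4 gates asym, D1 and NE2/3/4.»

## What (generic `d`)
* §1 **`blockSum_codiff₁_eq_faceFlux`** — the scalar divergence theorem on a block: `blockSum N (codiff₁ w) y₀ = Σ_μ (Σ_{v∈box, v μ = 0} w μ (N•y₀ + v − e_μ) −
  Σ_{v∈box, v μ = N−1} w μ (N•y₀ + v))` — the block total of a fine codifferential is the NET FLUX of `w` INTO the block through its `2(d+1)` faces; interior bonds cancel.
* §2 **`codiff₁_slotEntry_eq_divV`** ∕ **`blockSum_codiff₁_slotEntry_eq_boxSum_divV`** — for a kernel-valued slot field `S` and a fixed entry `(x′ z′ a′ b′)`: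
  `codiff₁ (κ u ↦ S κ u x′ z′ a′ b′) u₀ = divV S u₀ x′ z′ a′ b′` and `blockSum N (codiff₁ (κ u ↦ S κ u x′ z′ a′ b′)) y₀ = (Σ_{v∈box N} divV S (N•y₀ + toSite v)) x′ z′ a′ b′`
  — PAIR-COARSE's right side IS the «FLUX-REC» block-flux entry `Φ_{B(y₀)}(S)`.
* §3 THE LAW IN FLUX FORM, under a DISPLAYED assembly hypothesis `hW : ∀ κ u, W u x (inl κ) b = S κ u x′ z′ a′ b′` (an identification of the table's kernel ROW index
  `(κ, u)` at the column `(x, b)` with the SLOT index of a letter `S` at a fixed entry — NOT asserted here for any literal table; see READING AND ITS LIMIT): **`pow_mul_codiff₁_multiplierCol_eq_neg_boxSum_divV`** (`j = 0`, `bhK`):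
  `N^{d+1}·codiff₁ (κ y ↦ (G∘W)(N•y) x (inr κ) b) y₀ = −(Σ_{v∈box N} divV S (N•y₀ + toSite v)) x′ z′ a′ b′`; **`stepScale_mul_pow_mul_codiff₁_multiplierCol_eq_neg_boxSum_divV`**
  (step `j+1`, `bhKStep`): the same with `stepScale_{j+1}·Lc^{d+1}`; corollaries **`codiff₁_multiplierCol_eq_zero_of_fluxFree`** ∕ **`…_step`**: a letter that is
  FLUX-FREE on the block `y₀` (`Σ_{v∈box} divV S (Lc•y₀ + v) = 0` — e.g. every interior block of a boundary-layer letter, `FluxTowerCoClosed` ∕ `BlockFluxRegion.…_offLayers`)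
  makes the multiplier column coarse-co-closed AT `y₀`.
READING AND ITS LIMIT (leaf-01 g69 W-1, located; adopted): the `codiff₁` on the law's right side is the codifferential of the KERNEL `W` in its ROW (fine field-bond)
index at a fixed column.  §3 identifies that row index with a letter SLOT through the DISPLAYED hypothesis `hW` — under it the consumer's multiplier column reads only the
letter's TOTAL block flux, the object «FLUX-REC» transports and prices (sup ∕ `BiLoc` ∕ ℓ¹).  If instead the consumer's table rows are the letter's KERNEL field index
(an2 W4: the dressing `dressKAt` acts on the kernel legs; the born Wilson kernel's row codifferential is the CONTACT law — the OWNER's E35, nonzero), then the SAME law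
reads the block total of that KERNEL-INDEX divergence: §1's face-flux form applies to it verbatim (it is a fine 1-form in the row index), FLUX-REC's SLOT tower does NOT,
and `hW` is not the consumer's assembly.  Which of the two the (DL) read presents is an2's ∕ the OWNER's to say; no size is asserted either way.
Decides nothing about (Q-R) ∕ (DIV) ∕ (DL) ∕ K-LL-4′; NOTHING of (LT) ∕ (LAY) ∕ (S) ∕ «T2Shape» ∕ «T2Drift» ∕ (hW, hWall) discharged; 0 wall binders; NEVER «G-an2-4
closed» as (CONV-C); NOT D1, NOT `BetaPertH`, NOT continuum, NOT Clay; not in print — our bookkeeping.  Unit `b2b-balaban-gan24-formalise-leaf-03` (gen 63),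
2026-08-22; no existing file touched.
-/

noncomputable section

open Finset
open scoped BigOperators
open Literature.MathematicalPhysics.QuantumFieldTheory
open Literature.MathematicalPhysics.QuantumFieldTheory.Balaban1983to89
open Literature.MathematicalPhysics.QuantumFieldTheory.Balaban1983to89.Beta
open ExpKernelCalculus (Site MKer Decays comp)
open AffineAveraging (Form0 Form1 box toSite dz codiff₁ blockSum)
open AveragingContours (blk)
open KernelWard (divV)
open OneStepResolventKernel (Fib)
open OneStepKernelFamily (KInvStep)
open Summit.QuantumFields.BalabanUV.Beta.TameKernelCalculus
open Summit.QuantumFields.BalabanUV.Beta.ChartConjugationRelative (RelInv)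
open Summit.QuantumFields.BalabanUV.Beta.AxialDressingRooted (axEc coDressKBmAt one_le_of_neZero)
open Summit.QuantumFields.BalabanUV.Beta.BorderedHessian (bhK stepScale stepScale_pos bhKStep)
open Summit.QuantumFields.BalabanUV.Beta.GAN24.BlockDivergenceFlux (boxSum_sub_shift_eq_faces)
open Summit.QuantumFields.BalabanUV.Beta.GAN24.WardPairingCoarse (pow_mul_codiff₁_multiplierCol_eq)
open Summit.QuantumFields.BalabanUV.Beta.GAN24.WardPairingCoarseStep (stepScale_mul_pow_mul_codiff₁_multiplierCol_eq)

namespace Summit.QuantumFields.BalabanUV.Beta.GAN24.WardPairingCoarseFlux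

variable {d N : ℕ}

/-! ## §1 The scalar divergence theorem on a block -/

/-- [folklore] **THE BLOCK TOTAL OF A FINE CODIFFERENTIAL IS THE NET FACE FLUX INTO THE BLOCK**: `N ≥ 1` ⟹
`blockSum N (codiff₁ w) y₀ = Σ_μ (Σ_{v∈box, v μ = 0} w μ (N•y₀ + toSite v − e_μ) − Σ_{v∈box, v μ = N−1} w μ (N•y₀ + toSite v))` (my g58 `boxSum_sub_shift_eq_faces`, scalar). -/
theorem blockSum_codiff₁_eq_faceFlux (hN : 1 ≤ N) (w : Form1 (d + 1) ℝ) (y₀ : Fin (d + 1) → ℤ) :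
    blockSum N (codiff₁ w) y₀
      = ∑ μ : Fin (d + 1), ((∑ v ∈ (box (d + 1) N).filter (fun v => v μ = 0), w μ ((N : ℤ) • y₀ + toSite v - AffineAveraging.unitVec μ))
          - ∑ v ∈ (box (d + 1) N).filter (fun v => v μ = N - 1), w μ ((N : ℤ) • y₀ + toSite v)) := by
  classical
  simp only [AffineAveraging.blockSum, AffineAveraging.codiff₁]
  rw [Finset.sum_comm]
  refine Finset.sum_congr rfl fun μ _ => ?_
  have h := boxSum_sub_shift_eq_faces hN (w μ) y₀ μ
  rw [AveragingWardStencils.b6UnitVec_eq] at h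
  exact h

/-! ## §2 A table column that is a letter entry: `codiff₁` is `divV`, its block total is the block flux -/

section Slot

variable (S : Fin (d + 1) → (Fin (d + 1) → ℤ) → MKer (d + 1) (Fib d)) (x' z' : Fin (d + 1) → ℤ) (a' b' : Fib d)

/-- [folklore] an5's fine codifferential of a slot-field ENTRY is the entry of an2's slot divergence (same sign, same unit vectors by `b6UnitVec_eq`):
`codiff₁ (κ u ↦ S κ u x′ z′ a′ b′) u₀ = divV S u₀ x′ z′ a′ b′`. -/
theorem codiff₁_slotEntry_eq_divV (u₀ : Fin (d + 1) → ℤ) :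
    codiff₁ (fun κ u => S κ u x' z' a' b') u₀ = divV S u₀ x' z' a' b' := by
  simp only [AffineAveraging.codiff₁, KernelWard.divV, Finset.sum_apply, Pi.sub_apply, AveragingWardStencils.b6UnitVec_eq]

/-- [folklore] **THE BLOCK TOTAL OF A LETTER ENTRY's CODIFFERENTIAL IS THE «FLUX-REC» BLOCK-FLUX ENTRY**:
`blockSum N (codiff₁ (κ u ↦ S κ u x′ z′ a′ b′)) y₀ = (Σ_{v∈box N} divV S (N•y₀ + toSite v)) x′ z′ a′ b′`. -/
theorem blockSum_codiff₁_slotEntry_eq_boxSum_divV (y₀ : Fin (d + 1) → ℤ) :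
    blockSum N (codiff₁ (fun κ u => S κ u x' z' a' b')) y₀ = (∑ v ∈ box (d + 1) N, divV S ((N : ℤ) • y₀ + toSite v)) x' z' a' b' := by
  simp only [AffineAveraging.blockSum, codiff₁_slotEntry_eq_divV, Finset.sum_apply]

end Slot

/-! ## §3 The law in flux form -/

section FluxLaw

variable {S : Fin (d + 1) → (Fin (d + 1) → ℤ) → MKer (d + 1) (Fib d)} {x' z' : Fin (d + 1) → ℤ} {a' b' : Fib d}

/-- NOT IN PRINT; OUR BOOKKEEPING (PART 1's law ⨾ §2).  **THE LAW IN FLUX FORM, `j = 0`**: `RelInv G (bhK N) (axEc ρ N)`, `G`, `W` spread, and the table column `(x, b)` IS the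
letter entry `(x′ z′ a′ b′)` of a slot field `S` (`hW`, displayed) ⟹
`N^{d+1}·codiff₁ (κ y ↦ (G∘W)(N•y) x (inr κ) b) y₀ = −(Σ_{v∈box N} divV S (N•y₀ + toSite v)) x′ z′ a′ b′` — the multiplier column reads ONLY the letter's TOTAL block flux. -/
theorem pow_mul_codiff₁_multiplierCol_eq_neg_boxSum_divV [NeZero N] {ρ : Fin (d + 1) → ℤ} {G W : MKer (d + 1) (Fib d)}
    (hG : RelInv G (bhK N) (axEc ρ N)) (hGs : Spr G) (hWs : Spr W) {x : Fin (d + 1) → ℤ} {b : Fib d}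
    (hW : ∀ κ u, W u x (Sum.inl κ) b = S κ u x' z' a' b') (y₀ : Fin (d + 1) → ℤ) :
    ((N : ℝ) ^ (d + 1)) * codiff₁ (fun κ y => comp G W ((N : ℤ) • y) x (Sum.inr κ) b) y₀
      = -(∑ v ∈ box (d + 1) N, divV S ((N : ℤ) • y₀ + toSite v)) x' z' a' b' := by
  have h := pow_mul_codiff₁_multiplierCol_eq hG hGs hWs y₀ x b
  have e : (fun κ u => W u x (Sum.inl κ) b) = fun κ u => S κ u x' z' a' b' := by
    funext κ u; exact hW κ u
  rw [e, blockSum_codiff₁_slotEntry_eq_boxSum_divV] at h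
  exact h

/-- NOT IN PRINT; OUR BOOKKEEPING (PART 2's law ⨾ §2).  **THE LAW IN FLUX FORM, STEP `j + 1`**: `RelInv G (bhKStep d Lc (j+1)) (axEc ρ Lc)`, `G`, `W` spread, `hW` as above ⟹
`stepScale_{j+1}·Lc^{d+1}·codiff₁ (κ y ↦ (G∘W)(Lc•y) x (inr κ) b) y₀ = −(Σ_{v∈box Lc} divV S (Lc•y₀ + toSite v)) x′ z′ a′ b′`. -/
theorem stepScale_mul_pow_mul_codiff₁_multiplierCol_eq_neg_boxSum_divV {Lc : ℕ} [NeZero Lc] {ρ : Fin (d + 1) → ℤ} (j : ℕ) {G W : MKer (d + 1) (Fib d)}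
    (hG : RelInv G (bhKStep d Lc (j + 1)) (axEc ρ Lc)) (hGs : Spr G) (hWs : Spr W) {x : Fin (d + 1) → ℤ} {b : Fib d}
    (hW : ∀ κ u, W u x (Sum.inl κ) b = S κ u x' z' a' b') (y₀ : Fin (d + 1) → ℤ) :
    stepScale d Lc (j + 1) * (((Lc : ℝ) ^ (d + 1)) * codiff₁ (fun κ y => comp G W ((Lc : ℤ) • y) x (Sum.inr κ) b) y₀)
      = -(∑ v ∈ box (d + 1) Lc, divV S ((Lc : ℤ) • y₀ + toSite v)) x' z' a' b' := by
  have h := stepScale_mul_pow_mul_codiff₁_multiplierCol_eq j hG hGs hWs y₀ x b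
  have e : (fun κ u => W u x (Sum.inl κ) b) = fun κ u => S κ u x' z' a' b' := by
    funext κ u; exact hW κ u
  rw [e, blockSum_codiff₁_slotEntry_eq_boxSum_divV] at h
  exact h

/-- NOT IN PRINT; OUR BOOKKEEPING.  **COROLLARY — FLUX-FREE ON THE BLOCK ⟹ COARSE-CO-CLOSED THERE, `j = 0`**: if the letter's block flux through `B(y₀)` vanishes
(`Σ_{v∈box N} divV S (N•y₀ + toSite v) = 0` — e.g. every block off the two boundary layers of a label-block letter, `BlockFluxRegion.…_eq_zero_of_offLayers`), then
`codiff₁ (κ y ↦ (G∘W)(N•y) x (inr κ) b) y₀ = 0`. -/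
theorem codiff₁_multiplierCol_eq_zero_of_fluxFree [NeZero N] {ρ : Fin (d + 1) → ℤ} {G W : MKer (d + 1) (Fib d)}
    (hG : RelInv G (bhK N) (axEc ρ N)) (hGs : Spr G) (hWs : Spr W) {x : Fin (d + 1) → ℤ} {b : Fib d}
    (hW : ∀ κ u, W u x (Sum.inl κ) b = S κ u x' z' a' b') {y₀ : Fin (d + 1) → ℤ}
    (hflux : ∑ v ∈ box (d + 1) N, divV S ((N : ℤ) • y₀ + toSite v) = 0) :
    codiff₁ (fun κ y => comp G W ((N : ℤ) • y) x (Sum.inr κ) b) y₀ = 0 := by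
  have hN : 1 ≤ N := one_le_of_neZero N
  have h := pow_mul_codiff₁_multiplierCol_eq_neg_boxSum_divV hG hGs hWs hW y₀
  rw [hflux] at h
  simp only [Pi.zero_apply, neg_zero, mul_eq_zero] at h
  rcases h with h | h
  · exact absurd (pow_eq_zero_iff (Nat.succ_ne_zero d) |>.1 h) (by exact_mod_cast Nat.one_le_iff_ne_zero.1 hN)
  · exact h

/-- NOT IN PRINT; OUR BOOKKEEPING.  **COROLLARY — FLUX-FREE ON THE BLOCK ⟹ COARSE-CO-CLOSED THERE, STEP `j + 1`.** -/
theorem codiff₁_multiplierCol_eq_zero_of_fluxFree_step {Lc : ℕ} [NeZero Lc] {ρ : Fin (d + 1) → ℤ} (j : ℕ) {G W : MKer (d + 1) (Fib d)}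
    (hG : RelInv G (bhKStep d Lc (j + 1)) (axEc ρ Lc)) (hGs : Spr G) (hWs : Spr W) {x : Fin (d + 1) → ℤ} {b : Fib d}
    (hW : ∀ κ u, W u x (Sum.inl κ) b = S κ u x' z' a' b') {y₀ : Fin (d + 1) → ℤ}
    (hflux : ∑ v ∈ box (d + 1) Lc, divV S ((Lc : ℤ) • y₀ + toSite v) = 0) :
    codiff₁ (fun κ y => comp G W ((Lc : ℤ) • y) x (Sum.inr κ) b) y₀ = 0 := by
  have hLc : 1 ≤ Lc := one_le_of_neZero Lc
  have h := stepScale_mul_pow_mul_codiff₁_multiplierCol_eq_neg_boxSum_divV j hG hGs hWs hW y₀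
  rw [hflux] at h
  simp only [Pi.zero_apply, neg_zero, mul_eq_zero] at h
  rcases h with h | h | h
  · exact absurd h (ne_of_gt (stepScale_pos (d := d) (Lc := Lc) (j + 1)))
  · exact absurd (pow_eq_zero_iff (Nat.succ_ne_zero d) |>.1 h) (by exact_mod_cast Nat.one_le_iff_ne_zero.1 hLc)
  · exact h

/-- NOT IN PRINT; OUR BOOKKEEPING.  **COROLLARY — THE COUNT, ENTRYWISE**: `N^{d+1}·|codiff₁ (multiplier column) y₀| = |(Σ_{v∈box N} divV S (N•y₀ + v)) x′ z′ a′ b′|` — so every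
«FLUX-REC» bound on the block flux of the letter (sup: `BlockFluxRegion ∕ Tower`; `BiLoc`: `BlockFluxLocal`; ℓ¹: `BlockFluxMass ∕ Tower ∕ …Weight`) IS a bound on the
multiplier column's coarse divergence, with the factor `N^{−(d+1)}` (resp. `(stepScale·Lc^{d+1})⁻¹`). -/
theorem pow_mul_abs_codiff₁_multiplierCol_eq_abs_boxSum_divV [NeZero N] {ρ : Fin (d + 1) → ℤ} {G W : MKer (d + 1) (Fib d)}
    (hG : RelInv G (bhK N) (axEc ρ N)) (hGs : Spr G) (hWs : Spr W) {x : Fin (d + 1) → ℤ} {b : Fib d}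
    (hW : ∀ κ u, W u x (Sum.inl κ) b = S κ u x' z' a' b') (y₀ : Fin (d + 1) → ℤ) :
    ((N : ℝ) ^ (d + 1)) * |codiff₁ (fun κ y => comp G W ((N : ℤ) • y) x (Sum.inr κ) b) y₀|
      = |(∑ v ∈ box (d + 1) N, divV S ((N : ℤ) • y₀ + toSite v)) x' z' a' b'| := by
  have h := pow_mul_codiff₁_multiplierCol_eq_neg_boxSum_divV hG hGs hWs hW y₀
  rw [← abs_of_nonneg (by positivity : (0 : ℝ) ≤ (N : ℝ) ^ (d + 1)), ← abs_mul, h, abs_neg]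

end FluxLaw

end Summit.QuantumFields.BalabanUV.Beta.GAN24.WardPairingCoarseFlux

end
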